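import Mathlib
import HarnessLib
import Summits.HubbardSuperconductivity.HubbardSuperconductivity.Theorems.KLProgrammeC4aTadpoleJetAssemblyRef
import Summits.HubbardSuperconductivity.HubbardSuperconductivity.Theorems.KLProgrammeC4aCoMovingJetsL1Theta

/-!
# Route `KLProgramme` — crux C4a, the (A) capstone (reference-subtracted form) in SUP-OUTSIDE currency: the (L3) input as `CoMovingJetsL1Theta`
# (co-moving dominators that may depend on the base angle θ)

Cell `gate-hubbard-kl`, seat hubbard-kl-k3c3-p3 (g28; row «implicit-function / monotonicity route for μ(n)»).  Located brick for the (C)-closer lane hubbard-kl-c4a-1 /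
p1b (stub (C) `stub_twoLeg_curvature` of `KLRegimeEngineV17F2`, stmt-HubbardSuperconductivity-20437), memo HOME/hubbard-kl-k3c3-p3/U1-CAUSTIC-SUP.md §2 (F1).
WHY.  The (L3) input of `…C4aTadpoleJetAssemblyRef.twoLegCurveJetBound_succ_of_inputs_ref` is `CoMovingJetsL1 4 (aV p₀) r μ K (V_{p₀} − V★_{p₀})` with dominators
`aV p₀ i (ρ,ϑ)` UNIFORM in the base angle `θ`.  For the bubble piece of the fat vertex this cannot hold with `n`-free `∫dϑ aV p₀ 1`: along θ-orbits the configuration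
crosses umklapp caustics where `|∂_θ𝐁| ≍ Λ_n^{−1/2}` (one-sided Kohn cusp with a non-vanishing co-moving prefactor `X*`), for 63–88 % of the relative angles on
klWindowC (memo §5 (b)).  What the crux needs is pointwise in `θ` with the loop integral inside — `…C4aCoMovingJetsL1Theta` types that interface and its tube
tadpole-jet headline; this file re-threads the two consumer theorems, verbatim except for the (L3) slot:
* §1 **`abs_iteratedDeriv_re_tadpoleCont_comp_le_ref_theta`** — the one-line jets assembly with `hVJ : ∀ p₀, CoMovingJetsL1Theta N (aV p₀) r μ K (V_{p₀} − V★_{p₀})` and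
  `hMv : ∀ p₀ θ, ∀ i ≤ N, ∀ ρ ∈ (−r,r), ∫dϑ aV p₀ θ i (ρ,ϑ) ≤ Mv p₀ i`; same conclusion;
* §2 **`twoLegCurveJetBound_succ_of_inputs_ref_theta`** — THE (A) CAPSTONE in this form: `TwoLegCurveJetBound L M c c′ β U μ K (n+1)` from the value line, the θ-pointwise
  (L3) dominators, the Jacobian jets, the alias tables, the Fermi-point sizes and the fit inequalities — all named, same shapes as the `_ref` original.
Composition only; nothing is asserted about the Hubbard model's sizes; nothing asserts (C), K3 or superconductivity.
References: BGM 2006 §2.4 (2.36)–(2.42) [cite: BenfattoGiulianiMastropietro2006]; FST II CPAM 51 (1998) §3 [cite: FeldmanSalmhoferTrubowitz1998].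
-/

noncomputable section

namespace Summit.HubbardSuperconductivity.HubbardSuperconductivity.Theorems.C4a

set_option linter.dupNamespace false -- summit = problem name (single-conjunct summit), D-0017

open Real Set MeasureTheory Finset
open scoped ContDiff
open Literature.MathematicalPhysics.QuantumLattice Literature.MathematicalPhysics.QuantumLattice.BandSectorCounting Literature.Probability.LatticeModels
open GrassmannAlgebra
open Summit.HubbardSuperconductivity.HubbardSuperconductivity.Theorems.KLRegimeSplit
open Summit.HubbardSuperconductivity.HubbardSuperconductivity.Theorems.KLProgrammeLegKernels
open Summit.HubbardSuperconductivity.HubbardSuperconductivity.Theorems.KLRegimeWick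
open Summit.HubbardSuperconductivity.HubbardSuperconductivity.Theorems.DispersionFlow
open Summit.HubbardSuperconductivity.HubbardSuperconductivity.Theorems.PerturbedFermiCurve

/-! ## §1 The one-line jets with a reference vertex subtracted, θ-dependent dominators -/

section Assembly

variable {L M : ℕ} [NeZero L] [NeZero M]
variable {a b : ℝ} (B : BandBounds a b) {K : TrigPolyC4v} {A : ℝ}
  (hA : ∀ p : Momentum, ∀ j ≤ 2, ‖iteratedFDeriv ℝ j (frameShift K) p‖ ≤ A) (hADt : 2 * A < B.Dtmin)
  {μ r : ℝ} (hr : 0 < r) (hlo : a < μ - r - A) (hhi : μ + r + A < b)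
include B hA hADt hr hlo hhi

/-- **THE ONE-LINE JETS ASSEMBLY, reference-subtracted, SUP-OUTSIDE dominators.**  Twin of `…C4aTadpoleJetAssemblyRef.abs_iteratedDeriv_re_tadpoleCont_comp_le_ref` with
the (L3) input `CoMovingJetsL1Theta N (aV p₀) r μ K (V_{p₀} − V★_{p₀})` (dominators `aV p₀ θ i` per base angle, `∫dϑ aV p₀ θ i ≤ Mv p₀ i` for every `θ`).  As `…C4aTadpoleJetAssembly.abs_iteratedDeriv_re_tadpoleCont_comp_le`, for `1 ≤ j ≤ N ≤ 4`, but the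
(L3) input is `CoMovingJetsL1Theta N (aV p₀) r μ K (V_{p₀} − V★_{p₀})` for an arbitrary smooth θ-blind family `V★_{p₀} : Momentum → ℂ` (the bare / Hartree part drops):
`|∂_θʲ Re tadpoleCont(k_F^K θ)| ≤ (2π)⁻²·Σ_{p₀}(Σ_{i≤j} C(j,i)·G_i·Mv_{p₀,j−i})·∫_{(−r,r)}‖ŝ_{p₀}‖ + bell4 (k ↦ Lᵏ·mass·Σ_{p₀} tail_{p₀}) D j`.
[cite: BenfattoGiulianiMastropietro2006, §2.4 (2.36)] -/
theorem abs_iteratedDeriv_re_tadpoleCont_comp_le_ref_theta {β : ℝ} (hβ : β ≠ 0) {Λ Λ' : ℝ} (hΛ : 0 < Λ) (hΛΛ' : Λ ≤ Λ') (hΛr : Λ' < r)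
    (W : HubbardGrassmann L M) {N : ℕ} (hN : N ≤ 4)
    {G : ℕ → ℝ} (hJjet : ∀ ρ, |ρ| < r → ∀ i ≤ N, ∀ s, ‖iteratedDeriv i (fun s => levelChartJac μ K (ρ, s)) s‖ ≤ G i)
    {Vstar : MatsubaraIdx M → Momentum → ℂ} (hVstar : ∀ p₀, ContDiff ℝ ∞ (Vstar p₀))
    {aV : MatsubaraIdx M → ℝ → ℕ → ℝ × ℝ → ℝ}
    (hVJ : ∀ p₀ : MatsubaraIdx M, CoMovingJetsL1Theta N (aV p₀) r μ K (fun k q => tadpoleVertex β W p₀ k q - Vstar p₀ q))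
    {Mv : MatsubaraIdx M → ℕ → ℝ} (hMv : ∀ (p₀ : MatsubaraIdx M) (θ : ℝ), ∀ i ≤ N, ∀ ρ ∈ Ioo (-r) r, ∫ ϑ in Ioc 0 (2 * π), aV p₀ θ i (ρ, ϑ) ≤ Mv p₀ i)
    {Mdeg : ℕ} (hM : 4 ≤ Mdeg) {Da : MatsubaraIdx M → ℝ}
    (hDa : ∀ (p₀ : MatsubaraIdx M) (y : Momentum), ‖iteratedFDeriv ℝ Mdeg (fun y : Momentum =>
      sliceSymbolFnXi (β * (L : ℝ) ^ 2) 0 Λ Λ' (matsubaraFreq β M p₀) (frameLevel μ K ((2 * π) • y))) y‖ ≤ Da p₀)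
    (hγ : ContDiff ℝ 4 fun θ : ℝ => (WithLp.toLp 2 (klFermiPoint μ K θ) : Momentum)) {θ : ℝ} {D : ℕ → ℝ}
    (hD : ∀ i, 1 ≤ i → i ≤ 4 → ‖iteratedDeriv i (fun θ : ℝ => (WithLp.toLp 2 (klFermiPoint μ K θ) : Momentum)) θ‖ ≤ D i)
    {Mk : ℕ → ℝ}
    (hMk : ∀ k, Mk k = (L : ℝ) ^ k * (6 * |β| * (L : ℝ) ^ 4 * ∑ σ : Fin 2, ∑ τ : Fin 2, 2 * (((Fintype.card (SpaceTimeIdx L M) : ℝ) ^ 4)⁻¹ *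
        ∑ x : Fin 4 → SpaceTimeIdx L M, ‖positionKernel L M β W 4 (fun i => ((x i, ![σ, σ, τ, τ] i), (![0, 1, 1, 0] : Fin 4 → Fin 2) i))‖)) *
          ∑ p₀ : MatsubaraIdx M, Da p₀ / (2 * Real.pi) ^ Mdeg * (2 / (L : ℝ)) ^ (Mdeg - 4) * (4 * ∑' k : Fin 2 → ℤ, ∏ j, (1 + (k j : ℝ) ^ 2)⁻¹))
    {j : ℕ} (hj1 : 1 ≤ j) (hj : j ≤ N) :
    |iteratedDeriv j (fun θ : ℝ => (tadpoleCont β μ K Λ Λ' W (klFermiPoint μ K θ)).re) θ| ≤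
      ((2 * π) ^ 2)⁻¹ * (∑ p₀ : MatsubaraIdx M, (∑ i ∈ Finset.range (j + 1), (j.choose i : ℝ) * G i * Mv p₀ (j - i)) *
          ∫ ρ in Ioo (-r) r, ‖sliceSymbolFnXi (β * (L : ℝ) ^ 2) 0 Λ Λ' (matsubaraFreq β M p₀) ρ‖) +
        bell4 Mk D j := by
  have hj4 : j ≤ 4 := hj.trans hN
  -- the two pieces as named functions
  obtain ⟨TT, hTT⟩ : ∃ TT : MatsubaraIdx M → ℝ → ℂ, TT = fun p₀ θ =>
      ∫ q in {q : ℝ × ℝ | |q.1| < π ∧ |q.2| < π ∧ |frameLevel μ K (WithLp.toLp 2 ![q.1, q.2])| < r},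
        sliceSymbolFnXi (β * (L : ℝ) ^ 2) 0 Λ Λ' (matsubaraFreq β M p₀) (frameLevel μ K (WithLp.toLp 2 ![q.1, q.2])) *
          tadpoleVertex β W p₀ (levelPoint μ K 0 θ) (WithLp.toLp 2 ![q.1, q.2]) := ⟨_, rfl⟩
  obtain ⟨Al, hAl⟩ : ∃ Al : Momentum → ℂ, Al = fun P : Momentum =>
      ∑ p₀ : MatsubaraIdx M, ∑ y : TorusSite 2 L, tadpoleCoeff β W p₀ (WithLp.ofLp P) y * aliasErr β μ K Λ Λ' r p₀ y := ⟨_, rfl⟩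
  have hTTcd : ∀ p₀, ContDiff ℝ ∞ (TT p₀) := fun p₀ => by
    rw [hTT]
    exact contDiff_tubeTadpole B hA hADt hr hlo hhi (sliceSymbolFnXi_matsubara_contDiff hβ L M p₀ Λ Λ')
      (sliceSymbolFnXi_matsubara_tsupport_subset L M p₀ hΛ hΛΛ' hΛr) (contDiff_tadpoleVertex β W p₀)
  have hAlcd : ContDiff ℝ 4 Al := by rw [hAl]; exact contDiff_aliasSum β W _
  -- the decomposition along the curve
  have hdec : (fun θ : ℝ => (tadpoleCont β μ K Λ Λ' W (klFermiPoint μ K θ)).re) =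
      fun θ : ℝ => (∑ p₀ : MatsubaraIdx M, ((((2 * π) ^ 2)⁻¹ : ℝ) : ℂ) * TT p₀ θ).re +
        ((fun P : Momentum => (Al P).re) ∘ fun θ : ℝ => (WithLp.toLp 2 (klFermiPoint μ K θ) : Momentum)) θ := by
    funext θ'
    rw [tadpoleCont_eq_tubeTadpoles_add_alias hβ μ K Λ Λ' r W, Complex.add_re, hTT, hAl]
    simp only [Function.comp_apply, levelPoint_zero, Complex.real_smul]
  -- smoothness of the two pieces
  have hTT4 : ∀ p₀, ContDiff ℝ 4 (TT p₀) := fun p₀ => contDiff_infty.1 (hTTcd p₀) 4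
  have hTTj : ∀ p₀, ContDiff ℝ j (TT p₀) := fun p₀ => (hTT4 p₀).of_le (by exact_mod_cast hj4)
  have hsum : ContDiff ℝ 4 fun θ : ℝ => ∑ p₀ : MatsubaraIdx M, ((((2 * π) ^ 2)⁻¹ : ℝ) : ℂ) * TT p₀ θ :=
    ContDiff.sum fun p₀ _ => contDiff_const.mul (hTT4 p₀)
  have h1 : ContDiff ℝ 4 fun θ : ℝ => (∑ p₀ : MatsubaraIdx M, ((((2 * π) ^ 2)⁻¹ : ℝ) : ℂ) * TT p₀ θ).re :=
    Complex.reCLM.contDiff.comp hsum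
  have h2 : ContDiff ℝ 4 ((fun P : Momentum => (Al P).re) ∘ fun θ : ℝ => (WithLp.toLp 2 (klFermiPoint μ K θ) : Momentum)) :=
    (Complex.reCLM.contDiff.comp hAlcd).comp hγ
  rw [hdec, iteratedDeriv_fun_add (h1.contDiffAt.of_le (by exact_mod_cast hj4)) (h2.contDiffAt.of_le (by exact_mod_cast hj4))]
  refine (abs_add_le _ _).trans (add_le_add ?_ ?_)
  · -- the tube tadpoles
    refine (abs_iteratedDeriv_re_le (hsum.of_le (by exact_mod_cast hj4)) θ).trans ?_
    rw [iteratedDeriv_fun_sum fun p₀ _ => ((contDiff_const.mul (hTTj p₀)).contDiffAt :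
      ContDiffAt ℝ j (fun θ => ((((2 * π) ^ 2)⁻¹ : ℝ) : ℂ) * TT p₀ θ) θ)]
    refine (norm_sum_le _ _).trans ?_
    rw [Finset.mul_sum]
    refine Finset.sum_le_sum fun p₀ _ => ?_
    rw [iteratedDeriv_const_mul _ (hTTj p₀).contDiffAt, norm_mul,
      Complex.norm_real, Real.norm_of_nonneg (by positivity)]
    refine mul_le_mul_of_nonneg_left ?_ (by positivity)
    rw [hTT, iteratedDeriv_tubeTadpole_eq_sub_blind μ K r (sliceSymbolFnXi_matsubara_contDiff hβ L M p₀ Λ Λ').continuous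
      (contDiff_tadpoleVertex β W p₀).continuous (hVstar p₀).continuous hj1 θ]
    have hVd : ContDiff ℝ ∞ fun x : Momentum × Momentum => (fun k q => tadpoleVertex β W p₀ k q - Vstar p₀ q) x.1 x.2 :=
      (contDiff_tadpoleVertex β W p₀).sub ((hVstar p₀).comp contDiff_snd)
    exact norm_iteratedDeriv_tubeTadpole_le_of_L1Theta_unif B hA hADt hr hlo hhi (sliceSymbolFnXi_matsubara_contDiff hβ L M p₀ Λ Λ')
      (sliceSymbolFnXi_matsubara_tsupport_subset L M p₀ hΛ hΛΛ' hΛr) hJjet hVd (hVJ p₀) (hMv p₀) hj θ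
  · -- the aliasing term
    rw [hAl]
    exact abs_iteratedDeriv_re_aliasSum_comp_le_bell4 W
      (fun p₀ y => norm_aliasErr_le hβ μ K hΛ hΛΛ' hΛr p₀ hM (hDa p₀) y) hγ hD hMk hj4

/-! ## §2 The (A) capstone with a reference vertex subtracted, θ-dependent dominators -/

/-- **THE (A) CAPSTONE, reference-subtracted form, SUP-OUTSIDE dominators.**  Twin of `…C4aTadpoleJetAssemblyRef.twoLegCurveJetBound_succ_of_inputs_ref` with the
(L3) input in `CoMovingJetsL1Theta` form (memo HOME/hubbard-kl-k3c3-p3/U1-CAUSTIC-SUP.md §2).  As `…C4aSliceIncrementAssembly.twoLegCurveJetBound_succ_of_inputs_value` (value line `V₀`, tube-jet fit for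
`1 ≤ k ≤ 4`), with the (L3) dominators asked of `tadpoleVertex β 𝒱_n p₀ − V★_{p₀}` only. [cite: BenfattoGiulianiMastropietro2006, §2.4 (2.36)] -/
theorem twoLegCurveJetBound_succ_of_inputs_ref_theta {β : ℝ} (hβ : β ≠ 0) (U : ℝ) (n : ℕ)
    (hΛ : 0 < klScale klE0 (n + 1)) (hΛΛ' : klScale klE0 (n + 1) ≤ klScale klE0 n) (hΛr : klScale klE0 n < r)
    (hZ : hubbardEffPartitionFnCT L M β U μ 0 K (klScale klE0 n) ≠ 0)
    {G : ℕ → ℝ} (hJjet : ∀ ρ, |ρ| < r → ∀ i ≤ 4, ∀ s, ‖iteratedDeriv i (fun s => levelChartJac μ K (ρ, s)) s‖ ≤ G i)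
    {Vstar : MatsubaraIdx M → Momentum → ℂ} (hVstar : ∀ p₀, ContDiff ℝ ∞ (Vstar p₀))
    {aV : MatsubaraIdx M → ℝ → ℕ → ℝ × ℝ → ℝ}
    (hVJ : ∀ p₀ : MatsubaraIdx M, CoMovingJetsL1Theta 4 (aV p₀) r μ K
      (fun k q => tadpoleVertex β (klEffectiveAction L M β U μ K klE0 n) p₀ k q - Vstar p₀ q))
    {Mv : MatsubaraIdx M → ℕ → ℝ} (hMv : ∀ (p₀ : MatsubaraIdx M) (θ : ℝ), ∀ i ≤ 4, ∀ ρ ∈ Ioo (-r) r, ∫ ϑ in Ioc 0 (2 * π), aV p₀ θ i (ρ, ϑ) ≤ Mv p₀ i)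
    {Mdeg : ℕ} (hM : 4 ≤ Mdeg) {Da : MatsubaraIdx M → ℝ}
    (hDa : ∀ (p₀ : MatsubaraIdx M) (y : Momentum), ‖iteratedFDeriv ℝ Mdeg (fun y : Momentum =>
      sliceSymbolFnXi (β * (L : ℝ) ^ 2) 0 (klScale klE0 (n + 1)) (klScale klE0 n) (matsubaraFreq β M p₀) (frameLevel μ K ((2 * π) • y))) y‖ ≤ Da p₀)
    (hγ : ContDiff ℝ 4 fun θ : ℝ => (WithLp.toLp 2 (klFermiPoint μ K θ) : Momentum)) {D : ℕ → ℝ}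
    (hD : ∀ θ : ℝ, ∀ i, 1 ≤ i → i ≤ 4 → ‖iteratedDeriv i (fun θ : ℝ => (WithLp.toLp 2 (klFermiPoint μ K θ) : Momentum)) θ‖ ≤ D i)
    {Mk : ℕ → ℝ}
    (hMk : ∀ k, Mk k = (L : ℝ) ^ k * (6 * |β| * (L : ℝ) ^ 4 * ∑ σ : Fin 2, ∑ τ : Fin 2, 2 * (((Fintype.card (SpaceTimeIdx L M) : ℝ) ^ 4)⁻¹ *
        ∑ x : Fin 4 → SpaceTimeIdx L M, ‖positionKernel L M β (klEffectiveAction L M β U μ K klE0 n) 4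
          (fun i => ((x i, ![σ, σ, τ, τ] i), (![0, 1, 1, 0] : Fin 4 → Fin 2) i))‖)) *
          ∑ p₀ : MatsubaraIdx M, Da p₀ / (2 * Real.pi) ^ Mdeg * (2 / (L : ℝ)) ^ (Mdeg - 4) * (4 * ∑' k : Fin 2 → ℤ, ∏ j, (1 + (k j : ℝ) ^ 2)⁻¹))
    -- the one-line VALUE bound, uniformly in the angle
    {V₀ : ℝ} (hV₀ : ∀ θ : ℝ, |(tadpoleCont β μ K (klScale klE0 (n + 1)) (klScale klE0 n) (klEffectiveAction L M β U μ K klE0 n) (klFermiPoint μ K θ)).re| ≤ V₀)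
    {c c' : ℕ → ℝ}
    (hfit0 : V₀ +
        bell4 (twoPointMoment β
          (gaussConv ℂ (hubbardCovSliceCT L M β μ 0 K (klScale klE0 (n + 1)) (klScale klE0 n)) (klEffectiveAction L M β U μ K klE0 n) -
            klEffectiveAction L M β U μ K klE0 n -
            grassmannLaplacian ℂ (hubbardCovSliceCT L M β μ 0 K (klScale klE0 (n + 1)) (klScale klE0 n))
              (klEffectiveAction L M β U μ K klE0 n))) D 0 +
        bell4 (twoPointMoment β
          (effAction ℂ (hubbardCovSliceCT L M β μ 0 K (klScale klE0 (n + 1)) (klScale klE0 n)) (klEffectiveAction L M β U μ K klE0 n) -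
            gaussConv ℂ (hubbardCovSliceCT L M β μ 0 K (klScale klE0 (n + 1)) (klScale klE0 n)) (klEffectiveAction L M β U μ K klE0 n))) D 0 ≤
      curveJetBar c c' U 0 (n + 1))
    (hfit : ∀ k, 1 ≤ k → k ≤ 4 →
      ((2 * π) ^ 2)⁻¹ * (∑ p₀ : MatsubaraIdx M, (∑ i ∈ Finset.range (k + 1), (k.choose i : ℝ) * G i * Mv p₀ (k - i)) *
          ∫ ρ in Ioo (-r) r, ‖sliceSymbolFnXi (β * (L : ℝ) ^ 2) 0 (klScale klE0 (n + 1)) (klScale klE0 n) (matsubaraFreq β M p₀) ρ‖) +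
        bell4 Mk D k +
        bell4 (twoPointMoment β
          (gaussConv ℂ (hubbardCovSliceCT L M β μ 0 K (klScale klE0 (n + 1)) (klScale klE0 n)) (klEffectiveAction L M β U μ K klE0 n) -
            klEffectiveAction L M β U μ K klE0 n -
            grassmannLaplacian ℂ (hubbardCovSliceCT L M β μ 0 K (klScale klE0 (n + 1)) (klScale klE0 n))
              (klEffectiveAction L M β U μ K klE0 n))) D k +
        bell4 (twoPointMoment β
          (effAction ℂ (hubbardCovSliceCT L M β μ 0 K (klScale klE0 (n + 1)) (klScale klE0 n)) (klEffectiveAction L M β U μ K klE0 n) -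
            gaussConv ℂ (hubbardCovSliceCT L M β μ 0 K (klScale klE0 (n + 1)) (klScale klE0 n)) (klEffectiveAction L M β U μ K klE0 n))) D k ≤
      curveJetBar c c' U k (n + 1)) :
    TwoLegCurveJetBound L M c c' β U μ K (n + 1) := by
  have hlo' : a ≤ μ - A := by linarith
  have hhi' : μ + A ≤ b := by linarith
  obtain ⟨W, hW⟩ : ∃ W : HubbardGrassmann L M, W = klEffectiveAction L M β U μ K klE0 n := ⟨_, rfl⟩
  obtain ⟨R₁, hR₁⟩ : ∃ R₁ : HubbardGrassmann L M, R₁ =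
      gaussConv ℂ (hubbardCovSliceCT L M β μ 0 K (klScale klE0 (n + 1)) (klScale klE0 n)) (klEffectiveAction L M β U μ K klE0 n) -
        klEffectiveAction L M β U μ K klE0 n -
        grassmannLaplacian ℂ (hubbardCovSliceCT L M β μ 0 K (klScale klE0 (n + 1)) (klScale klE0 n)) (klEffectiveAction L M β U μ K klE0 n) :=
    ⟨_, rfl⟩
  obtain ⟨R₂, hR₂⟩ : ∃ R₂ : HubbardGrassmann L M, R₂ =
      effAction ℂ (hubbardCovSliceCT L M β μ 0 K (klScale klE0 (n + 1)) (klScale klE0 n)) (klEffectiveAction L M β U μ K klE0 n) -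
        gaussConv ℂ (hubbardCovSliceCT L M β μ 0 K (klScale klE0 (n + 1)) (klScale klE0 n)) (klEffectiveAction L M β U μ K klE0 n) := ⟨_, rfl⟩
  rw [← hW] at hVJ hMk hV₀
  rw [← hR₁, ← hR₂] at hfit hfit0
  set T : (Fin 2 → ℝ) → ℂ := fun P =>
    tadpoleCont β μ K (klScale klE0 (n + 1)) (klScale klE0 n) W P + localReadingCont β R₁ P + localReadingCont β R₂ P with hTdef
  have hT : T = fun P =>
      tadpoleCont β μ K (klScale klE0 (n + 1)) (klScale klE0 n) (klEffectiveAction L M β U μ K klE0 n) P +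
        localReadingCont β
          (gaussConv ℂ (hubbardCovSliceCT L M β μ 0 K (klScale klE0 (n + 1)) (klScale klE0 n)) (klEffectiveAction L M β U μ K klE0 n) -
            klEffectiveAction L M β U μ K klE0 n -
            grassmannLaplacian ℂ (hubbardCovSliceCT L M β μ 0 K (klScale klE0 (n + 1)) (klScale klE0 n))
              (klEffectiveAction L M β U μ K klE0 n)) P +
        localReadingCont β
          (effAction ℂ (hubbardCovSliceCT L M β μ 0 K (klScale klE0 (n + 1)) (klScale klE0 n)) (klEffectiveAction L M β U μ K klE0 n) -
            gaussConv ℂ (hubbardCovSliceCT L M β μ 0 K (klScale klE0 (n + 1)) (klScale klE0 n)) (klEffectiveAction L M β U μ K klE0 n)) P := by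
    rw [hTdef, hW, hR₁, hR₂]
  have h1 : ContDiff ℝ 4 fun θ : ℝ => (tadpoleCont β μ K (klScale klE0 (n + 1)) (klScale klE0 n) W (klFermiPoint μ K θ)).re :=
    IsCharPoly.contDiff_re_comp_klFermiPoint B hA hADt hlo' hhi' (isCharPoly_tadpoleCont β μ K _ _ W)
  have h2 : ContDiff ℝ 4 fun θ : ℝ => (localReadingCont β R₁ (klFermiPoint μ K θ)).re :=
    IsCharPoly.contDiff_re_comp_klFermiPoint B hA hADt hlo' hhi' (isCharPoly_localReadingCont β R₁)
  have h3 : ContDiff ℝ 4 fun θ : ℝ => (localReadingCont β R₂ (klFermiPoint μ K θ)).re :=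
    IsCharPoly.contDiff_re_comp_klFermiPoint B hA hADt hlo' hhi' (isCharPoly_localReadingCont β R₂)
  have hsplit : (fun θ' : ℝ => (T (klFermiPoint μ K θ')).re) = fun θ' : ℝ =>
      (tadpoleCont β μ K (klScale klE0 (n + 1)) (klScale klE0 n) W (klFermiPoint μ K θ')).re +
        (localReadingCont β R₁ (klFermiPoint μ K θ')).re + (localReadingCont β R₂ (klFermiPoint μ K θ')).re := by
    funext θ'
    rw [hTdef]
    simp only [Complex.add_re]
  refine twoLegCurveJetBound_succ_of_jets B hA hADt hlo' hhi' hβ U n hZ hT fun k hk θ => ?_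
  have hk' : (k : WithTop ℕ∞) ≤ 4 := by exact_mod_cast hk
  rw [hsplit, iteratedDeriv_fun_add ((h1.add h2).contDiffAt.of_le hk') (h3.contDiffAt.of_le hk'),
    iteratedDeriv_fun_add (h1.contDiffAt.of_le hk') (h2.contDiffAt.of_le hk')]
  refine (abs_add_le _ _).trans ((add_le_add ((abs_add_le _ _).trans (add_le_add le_rfl
    (abs_iteratedDeriv_re_localReadingCont_klFermiPoint_le β μ K R₁ hγ (hD θ) hk)))
    (abs_iteratedDeriv_re_localReadingCont_klFermiPoint_le β μ K R₂ hγ (hD θ) hk)).trans ?_)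
  rcases Nat.eq_zero_or_pos k with hk0 | hk1
  · subst hk0
    simp only [iteratedDeriv_zero]
    exact le_trans (by linarith [hV₀ θ]) hfit0
  · have htad := abs_iteratedDeriv_re_tadpoleCont_comp_le_ref_theta B hA hADt hr hlo hhi hβ hΛ hΛΛ' hΛr W le_rfl hJjet hVstar hVJ hMv hM hDa hγ (hD θ) hMk hk1 hk
    exact le_trans (by linarith [htad]) (hfit k hk1 hk)

end Assembly

end Summit.HubbardSuperconductivity.HubbardSuperconductivity.Theorems.C4a

end
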